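/-
Copyright (c) 2026. All rights reserved.
Released under Apache 2.0 license as described in the file LICENSE.
Authors: abc-iut cell, seat abc-iut-L4-t12 (discharge companion of abc-iut-L4-t9's block W2-B2).
-/
import Literature.AnabelianGeometry.AbsoluteAnabelian.PseudoShadows
import Literature.AnabelianGeometry.AbsoluteAnabelian.AbsTopIII.BiAnabelianTelecoreProofs
import Literature.AnabelianGeometry.AbsoluteAnabelian.AbsTopIII.BiAnabelianCoresProofs

/-!
# [AbsTopIII] Corollary 3.7 (ii) DISCHARGED: the family of homotopies `ℋ_δ` on `𝒟*`

S. Mochizuki, *Topics in absolute anabelian geometry III*, Cor 3.7 (ii) p. 88 (bib key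
`MochizukiAbsTopIII2015`; locators = kurims manuscript pages, lit key `paper:url-5493eb38cbb7`),
verbatim: "the collection of natural transformations `{θ_{□⋎}, θ_{□⋎}⁻¹, θ_⋎, θ_⋎⁻¹}_{⋎ ∈ L}`
— where we write `θ_{□⋎}` for the identity natural transformation from the arrow `δ_□ : 𝒳 → 𝒳` to
the composite arrow `pr_⋎ ∘ δ_⋎ : 𝒳 → 𝒳` and `θ_⋎ : 𝒟*_{[γ¹_⋎]} ⥲ 𝒟*_{[γ⁰_⋎]}` for the isomorphism
arising from `θ_𝒳` — generate a family of homotopies `ℋ_δ` on `𝒟*` [hence, in particular, by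
restriction, a contact structure on the telecore `𝔗_δ`]" — seat abc-iut-L4-t9's typed
statement `BiAnabelianSetting.DeltaFamilyStmt θ` (`BiAnabelianTelecore.lean`: a family on `𝒟*`
whose boundary set is EXACTLY the saturation of the generators `DeltaGen`, containing the printed
homotopies, `DeltaPinned`).  PROVED here for every `𝔖 : BiAnabelianSetting X E N` carrying the
bi-anabelian lift datum `θ^bi` of Cor 3.7 (ii) (`FiberSquare.BiAnabelianLift 𝔖.gal`), following t9's
design note (HOME/staging/L4/abc-iut-L4-t9/DISCHARGE-PLAN-Cor37.md §(ii)): the diagram `𝒟*`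
carries a PSEUDO-commuting shadow (`PseudoShadows.lean`) — shadows `𝒳` on the first two rows and the
core vertex (augmentation `π_𝒳` on row 1, FULLY FAITHFUL because `δ_𝒳` is an equivalence with
quasi-inverse `π_𝒳`, Cor 3.7 (ii) first sentence; the identity at `□` and at the core), `𝒩`, `𝔈`;
every edge 2-cell is an identity (`log_𝒳 ⋙ π = π`, `δ ⋙ π = 𝟭`, ...) EXCEPT `pr_⋎ ⋙ 𝟭 ≅ π`, which is
`θ^bi` itself.  The four kinds of generators have equal shadows, so `ℋ_δ := generatedFamily DeltaGen`
(`deltaFamily`); the pinned homotopies are recovered from uniqueness: `θ_{□⋎}` is the identity because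
`θ^bi` is trivial on the diagonal (t9's `θbi_app_diagonal`), `θ_⋎ = θ_𝒳` because both lie over the
identity of the second factor (t9's `thetaX_hom_app_snd`).  With t9's `starGaloisCoreStmt_holds`,
`cor_3_7_ii_iff` (p408214) and `telecoreDeltaStmt_holds` (p408929): `cor_3_7_ii_holds θ : 𝔖.Cor_3_7_ii θ`
— Cor 3.7 (ii) as typed holds for EVERY setting with `θ^bi`.  Refereed pre-IUT anabelian geometry;
nothing here bears on [IUTchIII] Cor 3.12.
-/

set_option autoImplicit false

namespace Literature.AnabelianGeometry.AbsoluteAnabelian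

open CategoryTheory Quiver DiagramOfCategories

universe v u w

/-! ## One more generic computation: the homotopies of a generated family through the augmentation -/

namespace DiagramOfCategories.PseudoShadow

variable {V : Type w} [Quiver.{v} V] {D : DiagramOfCategories.{v, u, w} V} (S : D.PseudoShadow)
  (ff : ∀ b : V, (S.aug b).FullyFaithful) (E₀ : ∀ ⦃a b : V⦄, Path a b → Path a b → Prop)
  (hE₀ : ∀ ⦃a b : V⦄ ⦃p q : Path a b⦄, E₀ p q → S.shP p = S.shP q)

/-- Components of the homotopies of the generated family lie over `can_[γ₁] ≫ can_[γ₂]⁻¹`.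
[cite: MochizukiAbsTopIII2015, Definition 3.5 (ii) p.75] -/
theorem map_generatedFamily_η_app {a b : V} {p q : Path a b}
    (h : (S.generatedFamily ff E₀ hE₀).E p q) (x : D.obj a) :
    (S.aug b).map (((S.generatedFamily ff E₀ hE₀).η h).app x) =
      eqToHom (by rw [D.pathFunctor_eq_pathFunctor']) ≫ S.canH p x ≫
        eqToHom (by rw [S.shP_eq_of_saturation E₀ hE₀ h]) ≫ S.canI q x ≫
        eqToHom (by rw [D.pathFunctor_eq_pathFunctor']) := by
  show (S.aug b).map ((eqToHom (D.pathFunctor_eq_pathFunctor' p) ≫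
    S.univ (ff b) p q (S.shP_eq_of_saturation E₀ hE₀ h) ≫
    eqToHom (D.pathFunctor_eq_pathFunctor' q).symm).app x) = _
  rw [NatTrans.comp_app, NatTrans.comp_app, eqToHom_app, eqToHom_app, Functor.map_comp,
    Functor.map_comp, eqToHom_map, eqToHom_map, map_univ_app]
  simp only [Category.assoc]

end DiagramOfCategories.PseudoShadow

namespace AbsTopIII

namespace FiberSquare.BiAnabelianLift

variable {X : Type u} [Category.{u} X] {E : Type u} [Category.{u} E] {Φ : X ⥤ E}
  (θ : BiAnabelianLift Φ)

/-- `θ^bi` is trivial on the diagonal: the inverse component too.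
[cite: MochizukiAbsTopIII2015, Cor 3.7 (ii) p.87] -/
theorem θbi_inv_app_diagonal (A : X) : θ.θbi.inv.app ((diagonal Φ).obj A) = 𝟙 A := by
  have e := θ.θbi.inv_hom_id_app ((diagonal Φ).obj A)
  rw [θ.θbi_app_diagonal] at e
  exact (Category.comp_id _).symm.trans e

end FiberSquare.BiAnabelianLift

namespace BiAnabelianSetting

variable {X E N : Type u} [Category.{u} X] [Category.{u} E] [Category.{u} N]
  (𝔖 : BiAnabelianSetting X E N)

/-! ## The pseudo-commuting shadow of `𝒟*` -/

section Shadow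

variable (X E N) in
/-- The shadow categories of `𝒟*`: `𝒳` on the first two rows and at the core vertex, `𝒩`, `𝔈`.
[cite: MochizukiAbsTopIII2015, Cor 3.7 (ii) p.87] -/
def deltaSh : Cor37Vertex → Cat.{u, u}
  | .first _ => Cat.of X
  | .box => Cat.of X
  | .space => Cat.of N
  | .galois => Cat.of E
  | .ref => Cat.of X

/-- The augmentations: `π_𝒳` (the projection to the second factor, the "universal reference model"
of Cor 3.7 (i)) on row 1, the identity elsewhere. [cite: MochizukiAbsTopIII2015, Cor 3.7 (ii) p.87] -/
def deltaAug : ∀ a : Cor37Vertex, 𝔖.starDiagram.obj a ⥤ deltaSh X E N a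
  | .first _ => 𝔖.proj
  | .box => 𝟭 X
  | .space => 𝟭 N
  | .galois => 𝟭 E
  | .ref => 𝟭 X

/-- The shadows of the edges: identities on rows ≤ 2 and the core, `λ^×`, `λ^{×pf}`, `𝒩 → 𝔈` above.
[cite: MochizukiAbsTopIII2015, Cor 3.7 (ii) p.87] -/
def deltaShe : ∀ {a b : Cor37Vertex}, Cor37Edge.{u} a b → (deltaSh X E N a ⥤ deltaSh X E N b)
  | _, _, .log _ _ _ => 𝟭 X
  | _, _, .pr _ => 𝟭 X
  | _, _, .lamTimes => 𝔖.lamTimes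
  | _, _, .lamTimesPf => 𝔖.lamTimesPf
  | _, _, .toGal => 𝔖.spaceGal
  | _, _, .proj _ => 𝟭 X
  | _, _, .diag _ => 𝟭 X
  | _, _, .diagBox => 𝟭 X

variable (θ : FiberSquare.BiAnabelianLift 𝔖.gal)

/-- The edge 2-cells: identities (`log_𝒳 ⋙ π = π`, `π ⋙ 𝟭 = π`, `δ ⋙ π = 𝟭`, `δ_□ = 𝟭`, and
`λ ⋙ 𝟭 = 𝟭 ⋙ λ`), except over `pr_⋎`, where `pr ⋙ 𝟭 ≅ π` is the bi-anabelian comparison `θ^bi`.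
[cite: MochizukiAbsTopIII2015, Cor 3.7 (ii) p.87] -/
def deltaCan : ∀ {a b : Cor37Vertex} (e : Cor37Edge.{u} a b),
    𝔖.starDiagram.map e ⋙ 𝔖.deltaAug b ≅ 𝔖.deltaAug a ⋙ 𝔖.deltaShe e
  | _, _, .log _ _ _ => Iso.refl _
  | _, _, .pr _ => θ.θbi
  | _, _, .lamTimes => Iso.refl _
  | _, _, .lamTimesPf => Iso.refl _
  | _, _, .toGal => Iso.refl _
  | _, _, .proj _ => Iso.refl _
  | _, _, .diag _ => Iso.refl _
  | _, _, .diagBox => Iso.refl _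

/-- **The pseudo-commuting shadow of `𝒟*` determined by `θ^bi`.**
[cite: MochizukiAbsTopIII2015, Cor 3.7 (ii) p.87] -/
def deltaShadow : 𝔖.starDiagram.PseudoShadow where
  Sh := deltaSh X E N
  aug := 𝔖.deltaAug
  she e := 𝔖.deltaShe e
  can e := 𝔖.deltaCan θ e

/-- The augmentations are fully faithful: `π_𝒳` because "`δ_𝒳` is an equivalence of categories, a
quasi-inverse for which is given by the projection to the second factor `π_𝒳 : 𝒳 ×_𝔈 𝒳 → 𝒳`"
(p. 87, verbatim; t9's `diagonalEquivalence`), the identities trivially.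
[cite: MochizukiAbsTopIII2015, Cor 3.7 (ii) p.87] -/
noncomputable def deltaFF : ∀ a : Cor37Vertex, ((𝔖.deltaShadow θ).aug a).FullyFaithful
  | .first _ => θ.diagonalEquivalence.fullyFaithfulInverse
  | .box => Functor.FullyFaithful.id X
  | .space => Functor.FullyFaithful.id N
  | .galois => Functor.FullyFaithful.id E
  | .ref => Functor.FullyFaithful.id X

/-- The generators of `ℋ_δ` have equal shadows (all shadows involved are identities of `𝒳`).
[cite: MochizukiAbsTopIII2015, Cor 3.7 (ii) p.88] -/
theorem deltaGen_shP {a b : Cor37Vertex} {p q : Path a b} (h : DeltaGen.{u} p q) :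
    (𝔖.deltaShadow θ).shP p = (𝔖.deltaShadow θ).shP q := by
  cases h <;> rfl

end Shadow

/-! ## The family `ℋ_δ` and Cor 3.7 (ii) -/

variable (θ : FiberSquare.BiAnabelianLift 𝔖.gal)

/-- **The family of homotopies `ℋ_δ` on `𝒟*`**: generated by `{θ_{□⋎}^{±1}, θ_⋎^{±1}}` — boundary set
the saturation of `DeltaGen`, homotopies the universal ones of the shadow.
[cite: MochizukiAbsTopIII2015, Cor 3.7 (ii) p.88] -/
noncomputable def deltaFamily : 𝔖.starDiagram.HomotopyFamily :=
  (𝔖.deltaShadow θ).generatedFamily (𝔖.deltaFF θ) DeltaGen.{u} (fun _ _ _ _ h => 𝔖.deltaGen_shP θ h)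

/-- `ℋ_δ` is generated by `DeltaGen`. [cite: MochizukiAbsTopIII2015, Cor 3.7 (ii) p.88] -/
theorem deltaFamily_isGeneratedBy :
    HomotopyFamily.IsGeneratedBy _ (𝔖.deltaFamily θ) DeltaGen.{u} :=
  (𝔖.deltaShadow θ).generatedFamily_isGeneratedBy _ _ _

/-- Identities at propositionally equal objects agree heterogeneously. [folklore] -/
private theorem id_heq_id {C : Type u} [Category.{u} C] {A B : C} (h : A = B) : 𝟙 A ≍ 𝟙 B := by
  subst h; rfl

/-- A functor applied to an `eqToHom`-conjugate is heterogeneously the functor applied to the middle.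
[folklore] -/
private theorem map_conj_eqToHom_heq {C D : Type u} [Category.{u} C] [Category.{u} D] (F : C ⥤ D)
    {A B B' A' : C} (a : A = B) (f : B ⟶ B') (b : B' = A') :
    F.map (eqToHom a ≫ f ≫ eqToHom b) ≍ F.map f := by
  subst a b; simp

/-- The computation behind `θ_{□⋎} = id`: over `□` the 2-cell of `([δ_□], [pr_⋎]∘[δ_⋎])` is
`θ^bi` at a diagonal object, hence trivial. [cite: MochizukiAbsTopIII2015, Cor 3.7 (ii) p.88] -/
theorem deltaShadow_box_aux (n : ℤ) (x : X) :
    (𝔖.deltaShadow θ).canH deltaBoxPath.{u} x ≫ eqToHom rfl ≫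
      (𝔖.deltaShadow θ).canI (prDeltaPath.{u} n) x = 𝟙 x := by
  show (𝟙 x ≫ 𝟙 x) ≫ eqToHom rfl ≫ ((𝟙 x ≫ 𝟙 x) ≫
    θ.θbi.inv.app ((FiberSquare.diagonal 𝔖.gal).obj x)) = 𝟙 x
  rw [θ.θbi_inv_app_diagonal]
  simp

/-- `θ_{□⋎}` in `ℋ_δ` is the identity (because `θ^bi` is trivial on the diagonal `δ_𝒳`).
[cite: MochizukiAbsTopIII2015, Cor 3.7 (ii) p.88] -/
theorem deltaFamily_η_box (n : ℤ) (x : X)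
    (e : (𝔖.starDiagram.pathFunctor deltaBoxPath.{u}).obj x =
      (𝔖.starDiagram.pathFunctor (prDeltaPath.{u} n)).obj x) :
    ((𝔖.deltaFamily θ).η ((𝔖.deltaShadow θ).generatedFamily_mem (𝔖.deltaFF θ) _ _
      (DeltaGen.boxFwd n))).app x = eqToHom e := by
  have E : 𝔖.starDiagram.pathFunctor deltaBoxPath.{u} =
      𝔖.starDiagram.pathFunctor (prDeltaPath.{u} n) := by
    rw [pathFunctor_eq_pathFunctor', pathFunctor_eq_pathFunctor']; rfl
  have hx : (𝔖.starDiagram.pathFunctor deltaBoxPath.{u}).obj x = x := by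
    rw [pathFunctor_eq_pathFunctor']; rfl
  have hφ := (𝔖.deltaShadow θ).generatedFamily_η_eq (𝔖.deltaFF θ) DeltaGen.{u}
    (fun _ _ _ _ h => 𝔖.deltaGen_shP θ h)
    ((𝔖.deltaShadow θ).generatedFamily_mem (𝔖.deltaFF θ) _ _ (DeltaGen.boxFwd n)) (eqToHom E)
    fun y => by
      show (eqToHom E).app y ≍ _
      rw [eqToHom_app]
      exact ((eqToHom_heq_id_dom _ _ _).trans (id_heq_id (by rw [pathFunctor_eq_pathFunctor']; rfl))).trans
        (heq_of_eq (𝔖.deltaShadow_box_aux θ n y).symm)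
  change _ = (𝔖.deltaFamily θ).η _ at hφ
  rw [← hφ, eqToHom_app]

/-- `θ_⋎` in `ℋ_δ` is `θ_𝒳` (both lie over the identity of the second factor).
[cite: MochizukiAbsTopIII2015, Cor 3.7 (ii) p.88] -/
theorem deltaFamily_η_theta (n : ℤ) (o : 𝔖.Sq)
    (e₁ : (𝔖.starDiagram.pathFunctor (gammaOne.{u} n)).obj o = (𝔖.proj ⋙ 𝔖.diag).obj o)
    (e₂ : (𝔖.starDiagram.pathFunctor (Path.nil : Path (Cor37Vertex.first n) _)).obj o = o) :
    ((𝔖.deltaFamily θ).η ((𝔖.deltaShadow θ).generatedFamily_mem (𝔖.deltaFF θ) _ _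
      (DeltaGen.thetaFwd n))).app o = eqToHom e₁ ≫ θ.thetaX.hom.app o ≫ eqToHom e₂.symm := by
  have E₁ : 𝔖.starDiagram.pathFunctor (gammaOne.{u} n) = 𝔖.proj ⋙ 𝔖.diag := by
    rw [pathFunctor_eq_pathFunctor']; rfl
  have E₂ : 𝟭 𝔖.Sq = 𝔖.starDiagram.pathFunctor (Path.nil : Path (Cor37Vertex.first n) _) := by
    rw [pathFunctor_nil]; rfl
  have hφ := (𝔖.deltaShadow θ).generatedFamily_η_eq (𝔖.deltaFF θ) DeltaGen.{u}
    (fun _ _ _ _ h => 𝔖.deltaGen_shP θ h)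
    ((𝔖.deltaShadow θ).generatedFamily_mem (𝔖.deltaFF θ) _ _ (DeltaGen.thetaFwd n))
    (eqToHom E₁ ≫ θ.thetaX.hom ≫ eqToHom E₂) fun y => by
      show 𝔖.proj.map ((eqToHom E₁ ≫ θ.thetaX.hom ≫ eqToHom E₂).app y) ≍ _
      rw [NatTrans.comp_app, NatTrans.comp_app, eqToHom_app, eqToHom_app]
      refine (map_conj_eqToHom_heq 𝔖.proj _ (θ.thetaX.hom.app y) _).trans ?_
      exact heq_of_eq (show (𝟙 y.snd : y.snd ⟶ y.snd) =
        (𝟙 _ ≫ (𝟙 _ ≫ 𝟙 _)) ≫ eqToHom rfl ≫ 𝟙 _ by simp)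
  change _ = (𝔖.deltaFamily θ).η _ at hφ
  rw [← hφ, NatTrans.comp_app, NatTrans.comp_app, eqToHom_app, eqToHom_app]

/-- `ℋ_δ` contains the printed homotopies on the generators.
[cite: MochizukiAbsTopIII2015, Cor 3.7 (ii) p.88] -/
theorem deltaFamily_pinned : 𝔖.DeltaPinned θ (𝔖.deltaFamily θ) :=
  ⟨fun n => ⟨(𝔖.deltaShadow θ).generatedFamily_mem (𝔖.deltaFF θ) _ _ (DeltaGen.boxFwd n),
      fun x e => 𝔖.deltaFamily_η_box θ n x e⟩,
    fun n => ⟨(𝔖.deltaShadow θ).generatedFamily_mem (𝔖.deltaFF θ) _ _ (DeltaGen.thetaFwd n),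
      fun o e₁ e₂ => 𝔖.deltaFamily_η_theta θ n o e₁ e₂⟩⟩

/-- **Cor 3.7 (ii), the family `ℋ_δ`: PROVED** for every setting with `θ^bi`.
[cite: MochizukiAbsTopIII2015, Cor 3.7 (ii) p.88] -/
theorem deltaFamilyStmt_holds : 𝔖.DeltaFamilyStmt θ :=
  ⟨𝔖.deltaFamily θ, 𝔖.deltaFamily_isGeneratedBy θ, 𝔖.deltaFamily_pinned θ⟩

/-- **Cor 3.7 (ii) (as typed by seat abc-iut-L4-t9) HOLDS** for every bi-anabelian setting with lift
datum `θ^bi`: telecore `𝔗_δ` + contact structure (`telecoreDeltaStmt_holds`), the family `ℋ_δ`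
(`deltaFamilyStmt_holds`), and `𝒟*` a core on `𝒟*_{≤3}` (t9's `starGaloisCoreStmt_holds`).
[cite: MochizukiAbsTopIII2015, Cor 3.7 (ii) pp.87–88] -/
theorem cor_3_7_ii_holds : 𝔖.Cor_3_7_ii θ :=
  ⟨𝔖.telecoreDeltaStmt_holds θ, 𝔖.deltaFamilyStmt_holds θ, 𝔖.starGaloisCoreStmt_holds⟩

end BiAnabelianSetting

end AbsTopIII

end Literature.AnabelianGeometry.AbsoluteAnabelian
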